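import Summits.RiemannHypothesis.RiemannHypothesis.Theorems.HardyZLehmerSplitSigmaLLaguerreEnergyDrift
import Literature.NumberTheory.LFunctions.LandauSiegelZerosLocalHypothesisHProofs
import HarnessLib

/-!
# Crux `SigmaL` (stmt-RiemannHypothesis-24253) — energy identity, part 5: the EXACT-CONE theorem and the
# exact-cone locators, as corollaries of the energy identity (route-independent imports)

Skeleton `SigmaL_birth`, registered stub `stub_laguerreAtCritical : ∀ t > 3·10¹², Z'(t) = 0 → Z(t) ≠ 0 →
Z(t)·Z''(t) < 0` (RH-strength, OPEN). The doubled-cone theorem `laguerreAtCritical_of_offCone`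
(`Theorems/HardyZLehmerSplitSigmaLLaguerreCone.lean`, leafhand g1) derives the stub's conclusion at `t` when
every zero `β + iγ` with `|γ − t| < 1` is on the line or has `2|β − ½| < |γ − t|`. From the energy identity
(parts 1–4) the aperture drops to the EXACT cone, boundary included:

* `re_zeroTerm_one_nonpos_of_exactCone` — if every zero with `|γ − t| < 1` has `|β − ½| ≤ |γ − t|`, every
  Hadamard pair term `Re Zₙ(1, ½+it)` is `≤ 0` (both members of each pair are zeros of `ξ`,
  `riemannXi_node_pair_eq_zero`; `|β − ½| ≤ ½` handles distant ordinates);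
* `exists_re_zeroTerm_one_le` — RH-free, some pair term is `≤ −1/100`: the zero with `t+1 < γ₀ ≤ t+9` from
  the explicit Riemann–von Mangoldt count (`SigmaLRung.zetaZeroCount_lt_add_eight` at `t + 1`), whatever
  its real part (`quarter_energy_ge`);
* `laguerreAtCritical_of_exactCone` — **EXACT-CONE THEOREM**: at a critical point `t ≥ 3·10¹²` of `Z` with
  `Z(t) ≠ 0`, if every zero with `|γ − t| < 1` satisfies `|β − ½| ≤ |γ − t|` then `Z(t)·Z''(t) < 0`
  (the Hadamard datum is the tree's `BasakThornerZaharescu2026.nonempty_symmHadamardData_riemannXi`);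
* `exists_zero_exactCone_of_laguerre_violation`, `exists_zero_exactCone_of_lehmer_violation` — the
  unconditional locators: a wrong-curvature critical point, in particular a Lehmer violation, at
  `t ≥ 3·10¹²` lies STRICTLY inside the exact cone `|γ − t| < |β − ½|` of some (off-line) zero.

(The parallel seat leafhand-2 announced a decrement-route proof of the same aperture; this is the
energy-route proof, independent of it.) NOTHING HERE PROVES OR ASSUMES RH; the stub and the crux stay OPEN.
References: Ivić 2003 §2 Prop. 1 [Ivic2003]; Trudgian 2014 (explicit `N(T)`, via the tree) [Trudgian2014].
-/

noncomputable section

set_option linter.dupNamespace false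
set_option autoImplicit false

open Complex Filter Set
open scoped Real Topology
open Literature.NumberTheory.LFunctions
open Literature.NumberTheory.LFunctions.Stark1974

namespace Summit.RiemannHypothesis.RiemannHypothesis.Theorems.SigmaLBirth

variable (D : SymmHadamardData riemannXi)

/-! ## The EXACT-CONE theorem as a corollary of the energy identity -/

/-- **Both members of a Hadamard pair are zeros of `ξ`:** `ξ(½ + ζₙ) = 0` and `ξ(½ − ζₙ) = 0` when
`cₙ ≠ 0` (the `n`-th factor of the product vanishes at `z = ζₙ`; `ξ(1−s) = ξ(s)` for the mirror).
Route-independent twin of `riemannXi_half_add_node` (`…EnergyReductions`). [cite: Conway1978, Ch. XI Thm. 3.4] -/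
theorem riemannXi_node_pair_eq_zero {n : ℕ} (hn : D.c n ≠ 0) :
    riemannXi (1 / 2 + D.node n) = 0 ∧ riemannXi (1 / 2 - D.node n) = 0 := by
  have hfac : 1 + D.c n * D.node n ^ 2 = 0 := by linear_combination D.c_mul_node_sq hn
  have hP : ∏' k, (1 + D.c k * D.node n ^ 2) = 0 :=
    (D.hasProd (D.node n)).unique (hasProd_zero_of_exists_eq_zero ⟨n, hfac⟩)
  have h1 : riemannXi (1 / 2 + D.node n) = 0 := by
    rw [D.prod_eq (D.node n), hP, mul_zero, mul_zero]
  refine ⟨h1, ?_⟩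
  have e : (1 : ℂ) - (1 / 2 + D.node n) = 1 / 2 - D.node n := by ring
  rw [← e, riemannXi_one_sub]
  exact h1

/-- Energy floor of a zero at ordinate distance between `1` and `9`: for `1 ≤ x ≤ 81`,
`(x − ¼)/(x + ¼)² ≥ 1/100`. [folklore] -/
theorem quarter_energy_ge {x : ℝ} (h1 : 1 ≤ x) (h81 : x ≤ 81) :
    1 / 100 ≤ (x - 1 / 4) / (x + 1 / 4) ^ 2 := by
  rw [div_le_div_iff₀ (by norm_num) (by positivity)]
  nlinarith [mul_nonneg (sub_nonneg.2 h1) (sub_nonneg.2 h81)]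

/-- **Off the EXACT cones every pair term is `≤ 0`.** If every zero `s` of `ζ` with `|Im s − t| < 1`
has `|Re s − ½| ≤ |Im s − t|` (`t` outside or on the boundary of its exact cone; on-line zeros qualify
trivially), then `Re Zₙ(1, ½+it) ≤ 0` for every Hadamard pair (zeros at ordinate distance `≥ 1` are
off-cone because `|Re s − ½| ≤ ½`). [folklore] -/
theorem re_zeroTerm_one_nonpos_of_exactCone {t : ℝ}
    (hcone : ∀ s : ℂ, riemannZeta s = 0 → |s.im - t| < 1 → |s.re - 1 / 2| ≤ |s.im - t|) (n : ℕ) :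
    (D.zeroTerm 1 (1 / 2 + (t : ℂ) * I) n).re ≤ 0 := by
  by_cases hn : D.c n = 0
  · simp [SymmHadamardData.zeroTerm, hn]
  have hβ : |(D.node n).re| ≤ 1 / 2 := D.abs_re_node_le hn
  -- the two zeros `½ ± ζₙ`
  obtain ⟨hξ1, hξ2⟩ := riemannXi_node_pair_eq_zero D hn
  obtain ⟨hζ1, -, -⟩ := (riemannXi_eq_zero_iff_holds _).1 hξ1
  obtain ⟨hζ2, -, -⟩ := (riemannXi_eq_zero_iff_holds _).1 hξ2
  have key1 : |(D.node n).re| ≤ |t - (D.node n).im| := by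
    by_cases h : |(D.node n).im - t| < 1
    · have := hcone _ hζ1 (by simpa using h)
      rw [abs_sub_comm] at this
      simpa [abs_sub_comm] using this
    · push Not at h
      rw [abs_sub_comm] at h
      linarith
  have key2 : |(D.node n).re| ≤ |t + (D.node n).im| := by
    by_cases h : |-(D.node n).im - t| < 1
    · have := hcone _ hζ2 (by simpa using h)
      have e1 : ((1 / 2 : ℂ) - D.node n).re - 1 / 2 = -(D.node n).re := by simp
      have e2 : ((1 / 2 : ℂ) - D.node n).im - t = -(t + (D.node n).im) := by simp; ring
      rw [e1, e2, abs_neg, abs_neg] at this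
      exact this
    · push Not at h
      have e : -(D.node n).im - t = -(t + (D.node n).im) := by ring
      rw [e, abs_neg] at h
      linarith
  refine re_zeroTerm_one_nonpos_of_offCone D ?_ ?_
  · calc (D.node n).re ^ 2 = |(D.node n).re| ^ 2 := (sq_abs _).symm
      _ ≤ |t - (D.node n).im| ^ 2 := by gcongr
      _ = (t - (D.node n).im) ^ 2 := sq_abs _
  · calc (D.node n).re ^ 2 = |(D.node n).re| ^ 2 := (sq_abs _).symm
      _ ≤ |t + (D.node n).im| ^ 2 := by gcongr
      _ = (t + (D.node n).im) ^ 2 := sq_abs _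

/-- **An RH-free energy witness:** for `t ≥ 3·10¹²` and `Z(t) ≠ 0` there is a Hadamard pair whose term is
`≤ −1/100`: the zero `ρ₀` with `t + 1 < γ₀ ≤ t + 9` supplied by the explicit Riemann–von Mangoldt count
(`SigmaLRung.zetaZeroCount_lt_add_eight` at `t + 1`), whatever its real part
(`re_zeroTerm_one_le_of_quarter_le`). [cite: Trudgian2014, Cor. 1 (explicit N(T), via the tree)] -/
theorem exists_re_zeroTerm_one_le {t : ℝ} (ht : 3000000000000 ≤ t) :
    ∃ n₀, (D.zeroTerm 1 (1 / 2 + (t : ℂ) * I) n₀).re ≤ -(1 / 100) := by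
  obtain ⟨ρ₀, hρ₀, hγt, hγ8⟩ := SigmaLRung.exists_zero_of_count_lt (by norm_num)
    (SigmaLRung.zetaZeroCount_lt_add_eight (by linarith : (3000000000000 : ℝ) ≤ t + 1))
  have him0 : ρ₀.im ≠ 0 := by intro h; rw [h] at hγt; linarith
  obtain ⟨h0, h1⟩ := re_mem_Ioo_of_riemannZeta_eq_zero_of_im_ne_zero hρ₀ him0
  have hξ0 : riemannXi ρ₀ = 0 := (riemannXi_eq_zero_iff_holds _).2 ⟨hρ₀, h0, h1⟩
  have hρhalf : ρ₀ ≠ 1 / 2 := by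
    intro h
    have := congrArg Complex.im h
    simp at this
    exact him0 this
  obtain ⟨n₀, hn₀, hroot⟩ := D.exists_index_of_zero hξ0 hρhalf
  refine ⟨n₀, ?_⟩
  -- ordinates of the pair: `(node n₀).im = ±γ₀`
  have him : (t - (D.node n₀).im) ^ 2 = (t - ρ₀.im) ^ 2 ∧ (t + (D.node n₀).im) ^ 2 = (t + ρ₀.im) ^ 2 ∨
      (t - (D.node n₀).im) ^ 2 = (t + ρ₀.im) ^ 2 ∧ (t + (D.node n₀).im) ^ 2 = (t - ρ₀.im) ^ 2 := by
    rcases D.eq_half_add_or_sub_node hn₀ hroot with h | h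
    · left
      have : (D.node n₀).im = ρ₀.im := by
        have := congrArg Complex.im h; simp at this; linarith
      rw [this]; exact ⟨rfl, rfl⟩
    · right
      have : (D.node n₀).im = -ρ₀.im := by
        have := congrArg Complex.im h; simp at this; linarith
      rw [this]; constructor <;> ring
  have hx1 : 1 ≤ (t - ρ₀.im) ^ 2 := by nlinarith
  have hx81 : (t - ρ₀.im) ^ 2 ≤ 81 := by nlinarith
  have hy : 1 / 4 ≤ (t + ρ₀.im) ^ 2 := by nlinarith
  have hfloor := quarter_energy_ge hx1 hx81
  have hother : 0 ≤ ((t + ρ₀.im) ^ 2 - 1 / 4) / ((t + ρ₀.im) ^ 2 + 1 / 4) ^ 2 :=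
    div_nonneg (by linarith) (by positivity)
  rcases him with ⟨e1, e2⟩ | ⟨e1, e2⟩
  · have h := re_zeroTerm_one_le_of_quarter_le D hn₀ (t := t) (by rw [e1]; linarith) (by rw [e2]; exact hy)
    rw [e1, e2] at h
    linarith
  · have h := re_zeroTerm_one_le_of_quarter_le D hn₀ (t := t) (by rw [e1]; exact hy) (by rw [e2]; linarith)
    rw [e1, e2] at h
    linarith

/-- **EXACT-CONE THEOREM (RH-free, from the energy identity).** Let `t ≥ 3·10¹²` be a critical point of
Hardy's `Z` with `Z(t) ≠ 0`. If every zero `s = β + iγ` of `ζ` with `|γ − t| < 1` has `|β − ½| ≤ |γ − t|`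
(`t` outside or ON THE BOUNDARY of its exact cone — on-line zeros qualify), then `Z(t)·Z''(t) < 0`.
Sharpens the doubled-cone theorem `laguerreAtCritical_of_offCone` (aperture `2|β − ½|`, strict) of
`Theorems/HardyZLehmerSplitSigmaLLaguerreCone.lean`: every pair term is `≤ 0`
(`re_zeroTerm_one_nonpos_of_exactCone`) and one RH-free zero at ordinate distance `∈ (1, 9]` contributes
`≤ −1/100 < −4/t` (`exists_re_zeroTerm_one_le`), so the energy surplus criterion
`laguerreAtCritical_of_energy` fires (with the tree's Hadamard datum of `ξ`,
`BasakThornerZaharescu2026.nonempty_symmHadamardData_riemannXi`). The stub stays OPEN; nothing here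
bears on the truth of RH. [cite: Ivic2003, §2 Prop. 1 (exact-cone form)] -/
theorem laguerreAtCritical_of_exactCone {t : ℝ} (ht : 3000000000000 ≤ t)
    (hcone : ∀ s : ℂ, riemannZeta s = 0 → |s.im - t| < 1 → |s.re - 1 / 2| ≤ |s.im - t|)
    (hd : deriv hardyZ t = 0) (hZ : hardyZ t ≠ 0) :
    hardyZ t * deriv (deriv hardyZ) t < 0 := by
  obtain ⟨D⟩ := BasakThornerZaharescu2026.nonempty_symmHadamardData_riemannXi
  obtain ⟨n₀, hn₀⟩ := exists_re_zeroTerm_one_le D ht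
  have hsum := tsum_re_zeroTerm_le_sum D hZ {n₀} (fun n _ ↦ re_zeroTerm_one_nonpos_of_exactCone D hcone n)
  rw [Finset.sum_singleton] at hsum
  refine laguerreAtCritical_of_energy D (by linarith) hd hZ ?_
  have h4 : 4 / t < 1 / 100 := by
    rw [div_lt_div_iff₀ (by linarith) (by norm_num)]; linarith
  linarith

/-- **EXACT-CONE LOCATOR (RH-free, unconditional):** a wrong-curvature or degenerate critical point of
`Z` at `t ≥ 3·10¹²` (`Z'(t) = 0`, `Z(t) ≠ 0`, `Z(t)·Z''(t) ≥ 0`) forces a zero `β + iγ` of `ζ` with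
`|γ − t| < |β − ½|` — STRICTLY inside its exact cone, in particular OFF the critical line, within ordinate
distance `< ½` of `t`. (Was: `|γ − t| ≤ 2|β − ½|`, `exists_offLine_zero_cone_of_laguerre_violation`.)
Nothing here bears on the truth of RH. [cite: Ivic2003, §2 Prop. 1 (contrapositive, exact cone)] -/
theorem exists_zero_exactCone_of_laguerre_violation {t : ℝ} (ht : 3000000000000 ≤ t)
    (hd : deriv hardyZ t = 0) (hZ : hardyZ t ≠ 0) (hL : 0 ≤ hardyZ t * deriv (deriv hardyZ) t) :
    ∃ s : ℂ, riemannZeta s = 0 ∧ |s.im - t| < |s.re - 1 / 2| := by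
  by_contra h
  push Not at h
  have hcone : ∀ s : ℂ, riemannZeta s = 0 → |s.im - t| < 1 → |s.re - 1 / 2| ≤ |s.im - t| :=
    fun s hs _ ↦ h s hs
  exact absurd hL (not_le.2 (laguerreAtCritical_of_exactCone ht hcone hd hZ))

/-- **EXACT-CONE LOCATOR for Lehmer violations (RH-free, unconditional):** a positive local minimum or a
negative local maximum of Hardy's `Z` at `t ≥ 3·10¹²` lies STRICTLY inside the exact cone of some zero of
`ζ`: there is a zero `β + iγ` with `|γ − t| < |β − ½|` (so `β ≠ ½` and `|γ − t| < ½`). The crux `SigmaL`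
stays OPEN; nothing here bears on the truth of RH. [cite: Ivic2003, §2 Prop. 1 (contrapositive, exact cone)] -/
theorem exists_zero_exactCone_of_lehmer_violation {t : ℝ} (ht : 3000000000000 ≤ t)
    (hv : (IsLocalMin hardyZ t ∧ 0 < hardyZ t) ∨ (IsLocalMax hardyZ t ∧ hardyZ t < 0)) :
    ∃ s : ℂ, riemannZeta s = 0 ∧ |s.im - t| < |s.re - 1 / 2| := by
  rcases hv with ⟨hmin, hpos⟩ | ⟨hmax, hneg⟩
  · obtain ⟨hd, hdd⟩ := (stub_secondDerivTest t).1 hmin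
    exact exists_zero_exactCone_of_laguerre_violation ht hd hpos.ne' (mul_nonneg hpos.le hdd)
  · obtain ⟨hd, hdd⟩ := (stub_secondDerivTest t).2 hmax
    exact exists_zero_exactCone_of_laguerre_violation ht hd hneg.ne
      (mul_nonneg_of_nonpos_of_nonpos hneg.le hdd)

end Summit.RiemannHypothesis.RiemannHypothesis.Theorems.SigmaLBirth

end
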